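import Summits.CriticalPhenomena.PercolationContinuityZ3.Theorems.PercNearOneGluingNoHeavyLowerTailThreePartitionJunta3Check

/-!
# `NoHeavyLowerTail` (crux stmt-CriticalPhenomena-4575), master-family hierarchy P3 (gen 37): the 3-JUNTA certificate check, twist codes 4–7

Support file (seat `prim-masterthm-p3`; `--supports stmt-CriticalPhenomena-4575`). Continuation of `…ThreePartitionJunta3Check` (kernel evaluation of
`checkT t` for `t = 4, 5, 6, 7`; ≈ 1 min each). [this work]
-/

namespace Summit.CriticalPhenomena.PercolationContinuityZ3.Theorems.ThreePartition.Junta3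

/-- The finite check, twist code 4 (kernel evaluation). [this work] -/
theorem checkT_4 : checkT 4 = true := by decide +kernel
/-- The finite check, twist code 5. [this work] -/
theorem checkT_5 : checkT 5 = true := by decide +kernel
/-- The finite check, twist code 6. [this work] -/
theorem checkT_6 : checkT 6 = true := by decide +kernel
/-- The finite check, twist code 7. [this work] -/
theorem checkT_7 : checkT 7 = true := by decide +kernel

/-- All eight twist codes check. [this work] -/
theorem checkT_all : ∀ t, t < 8 → checkT t = true
  | 0, _ => checkT_0
  | 1, _ => checkT_1
  | 2, _ => checkT_2
  | 3, _ => checkT_3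
  | 4, _ => checkT_4
  | 5, _ => checkT_5
  | 6, _ => checkT_6
  | 7, _ => checkT_7
  | _ + 8, h => absurd h (by omega)

end Summit.CriticalPhenomena.PercolationContinuityZ3.Theorems.ThreePartition.Junta3
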